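import Summits.QuantumFields.YangMills.Theorems.BalabanUVNodesN15PerCubeGreenFineRows
import Summits.QuantumFields.YangMills.Theorems.BalabanUVNodesN15TwoSpacingGluingCurvedCoverDefectRows
import Summits.QuantumFields.YangMills.Theorems.BalabanUVNodesN15BumpCoverTwoGrid
import HarnessLib

/-!
# N15 = NE2 — PROGRAMME (PC-E), (C5) by name: 335's TWO-GRID FIT ∕ SUPPORT ∕ STEP ∕ TAIL ROWS ON THE (PC) SITE CARRIERS — the bond rows of dag-n15-w4 `…BumpCoverTwoGrid`∕`…BumpCoverLift`
# and n15-c g15 FILEs 121∕122 (`…TwoSpacingGluingCurvedCoverDefectRows`) READ AT THE SLICE `(x, 0)` along King's pairing `kingPr`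

Cell `pub-ymgap`, seat `pub-ymgap-dag-n15-a` (generation g37; KNIT-BY-NAME, count-neutral; HUMAN RULING D-0062; chair R424 venue).  `bears_on: R4∕N15 · K3⁸
SpineGivenEndpointR13SepCoPHV (stmt-QuantumFields-27366)`; filed `--supports stmt-QuantumFields-27366 --as helper` — COUNT-NEUTRAL.  THEOREMS only ([folklore] bookkeeping:
every row is a landed BOND row specialised at the bond `(x′, 0)`), 0 `def`, 0 `sorry`.  Imports BY NAME n15-c∕261′ `…PerCubeGreenFineRows` (the (PC) site objects on both grids,
`mulOp_scH_comp_scQQ_comp_one_sub_scBump`∕`′`; through it dag-n15-w4 `…BumpCoverLift` §3), dag-n15-w4 `…BumpCoverTwoGrid` (`abs_bcube_cover_fine_sub_le`), n15-c g15 FILE 122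
`…TwoSpacingGluingCurvedCoverDefectRows` (`abs_fgrad∕bgrad∕fgradAdj_fgrad_coverH_lift_two_grid_le`, `abs_coverH_sub_coverHb_kingPrV_le`, `dist_blockOf_kingPrV_step_le`,
`blockOf_kingPrV_mem_cubeBlocks_of_inner_ne_zero`∕`_of_chiCube_ne_zero`; through it FILE 67 `abs_coverH_fine_sub_le`, n15-c∕119 `cvSk`).  The dictionary is n15-c∕260∕260′:
`scShift_apply`∕`scShift'_apply` (rfl), `scShift_symm_apply`∕`scShift'_symm_apply`, `scBump_eq`∕`scBump'_eq`, `scXi_eq_coverXi` (rfl), dag-n15-a `kingPrV_eq` (rfl).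
Nothing in the tree is modified, no landed name re-declared.

WHY (dag-n15-c g31 BY-NAME ASK I.21201, 2026-08-30T23:56:53Z; `PCE-DESIGN-g31.md` §7 SLOT TABLE «bump∕partition fits across π ↦ NEW on sites»).  (C5) = the SITE instantiation of
n15-c∕335 `uN_hasMaj_idef_glueInv_smoothCutDressed_localGauges_tr` with `X := ScX d L mv kk hL`, `X′ := ScX′ d L mv kk r hL`, `π := kingPr L kk r (cvM…)`, `blk := scBlk`,
`τ := scShift`, `τ′ := scShift′`, `η⁻¹ := L^kk`, `η′⁻¹ := L^r·L^kk`, `χtX := scBump`, `hX := scH`, `χX := scChi`, `ψX := scPsi` (′ likewise), `Sk := cvSk`,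
`hb := coverHb (cvM…) (L^kk) (L^mv) L`, `NL := scQQ a ι`, `N k := scCube a ι k` (′ likewise).  THIS FILE supplies its binders `hfitχ hfit₁ hfit₁b hfit₂ hfit₂b hf1 hf1b hf2 hfh hrh′
hstep′ hSχ hSψ hSχ′ hSψ′ hDT` in exactly those letters.

RESULTS ([folklore]; `w = L^mv`; section hypotheses `hM : cvM… ν = 2L·w`, `hw : 0 < w`)
* §1 bump fits: `abs_scBump'_sub_scBump_kingPr_le` (`hfitχ`, `π(d+1)∕(L^kk w)`), `abs_scBump'_scShift'_sub_le`∕`abs_scBump'_scShift'_symm_sub_le` (`hfit₁`∕`hfit₁b`, `2π(d+1)∕(L^kk w)`),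
  `abs_fgrad_scBump'_sub_le`∕`abs_bgrad_scBump'_sub_le` (`hfit₂`∕`hfit₂b`, `w⁻¹(L^kk w)⁻¹(32π⁴ + π²(d+1))`, `4 ≤ L`).
* §2 partition fits: `abs_fgrad_scH'_sub_le`∕`abs_bgrad_scH'_sub_le` (`hf1`∕`hf1b`, `|w⁻¹|(L^kk w)⁻¹(64π² + π²|Fin(d+1)|)`, `3 ≤ L^kk w`), `abs_fgradAdj_fgrad_scH'_sub_le` (`hf2`,
  `(w⁻¹)²(L^kk w)⁻¹(144π³ + 32π³|Fin(d+1)|)`), `abs_scH'_sub_scH_kingPr_le` (`hfh`, `π(d+1)∕(L^kk w)`), `abs_scH'_sub_coverHb_kingPr_le` (`hrh′`, `π(d+1)∕w`).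
* §3 geometry ∕ supports: `dist_scBlk_kingPr_scShift'_le` (`hstep′`, `≤ 1`), `scBlk_mem_cvSk_of_scChi_ne_zero`∕`_of_scPsi_ne_zero` (`hSχ`∕`hSψ`),
  `scBlk_kingPr_mem_cvSk_of_scChi'_ne_zero`∕`_of_scPsi'_ne_zero` (`hSχ′`∕`hSψ′`; margin hyps `hm₁ hfitI hS0` for the `χ` rows).
* §4 the tail defect: `hasMaj_idef_tail_scCube` (`hDT` with ANY `rF ≥ 0`, any `ρT`, any masses `a a′`: both tail operators VANISH on sites, 261∕261′).

HONEST FRAMING ∕ LIMITS.  Bookkeeping only — every analytic input is a landed bond row; MODEL carriers; nothing of [B9] asserted; NE2⁺ NOT PRINTED, NOT proved; N15 of record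
untouched (DISCHARGED AS CONSUMED, p687738); K3⁸ OPEN; counts of record UNMOVED (typed 28∕28 · discharged 8∕27); one finite 𝕋⁴ at fixed ε per index — NOT infinite volume, NOT
OS on ℝ⁴, NOT a mass gap, NOT Clay.  Restate-immune (no Theses import).
-/

noncomputable section

open scoped BigOperators Matrix
open Finset

namespace Summit.QuantumFields.YangMills.BalabanUVNodes.N15.Gluing

open Real
open Literature.MathematicalPhysics.QuantumFieldTheory.Balaban1983to89
open Literature.MathematicalPhysics.QuantumFieldTheory.Balaban1983to89.B5Prop11Plancherel (Tor fine unitVec)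
open Literature.MathematicalPhysics.QuantumFieldTheory.Balaban1983to89.B11SectG (BlockNorm HasMaj hasMaj_zero)
open Literature.MathematicalPhysics.QuantumFieldTheory.Balaban1983to89.B6Prop26Gluing (mulOp mulOp_apply ind ind_nonneg)
open Literature.MathematicalPhysics.QuantumFieldTheory.Balaban1983to89.B6UnitTorusCarrier (unitTorusGeo)
open Literature.MathematicalPhysics.QuantumFieldTheory.Balaban1983to89.T4EtaRateDefect (idef idef_zero)
open Literature.MathematicalPhysics.QuantumFieldTheory.Balaban1983to89.T4EtaRateCoeffDefect (pull)
open Literature.MathematicalPhysics.QuantumFieldTheory.King1986.Torus (blockOf)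
open Summit.QuantumFields.YangMills.BalabanUVNodes.N15.BackgroundLayer (fgrad bgrad fgradAdj fgrad_apply bgrad_apply fgradAdj_apply)
open Summit.QuantumFields.YangMills.BalabanUVNodes.N15.VectorPiece (kingPr kingPrV kingPrV_eq bshiftEquiv)
open Summit.QuantumFields.YangMills.BalabanUVNodes.N15.MatrixSpecies (liftBlk liftMap liftEquiv liftEquiv_apply liftEquiv_symm_apply)
open Summit.QuantumFields.YangMills.BalabanUVNodes.N15.TwoGrid (chiCube cubeBlocks chiCube_of_not_mem)

variable {d : ℕ}

variable {L : ℕ} [NeZero L] {mv kk r : ℕ} {hL : Odd L ∧ 1 < L} (ι : Type)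
variable (hM : ∀ ν, cvM d L mv kk hL ν = 2 * L * L ^ mv) (hw : 0 < L ^ mv)

/-! ## §1 The bump's two-grid fits on sites (`hfitχ`, `hfit₁`, `hfit₁b`, `hfit₂`, `hfit₂b`) -/

section Bump

include hM hw

/-- ★ `hfitχ` ON SITES: `|χ̃′_k(x′) − χ̃_k(πx′)| ≤ π(d+1)∕(L^kk w)` (dag-n15-w4 `abs_bcube_cover_fine_sub_le` at the bond `(x′, 0)`).
[cite: Balaban1985BackgroundPropagators, (3.62)–(3.65) pp.402–403 (shape), Thm 3.14 pp.426–427 (difference template)] -/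
theorem abs_scBump'_sub_scBump_kingPr_le (k : Fin (d + 1) → ZMod (2 * L)) (x' : ScX' d L mv kk r hL) :
    |scBump' d L mv kk r hL k x' - scBump d L mv kk hL k (kingPr L kk r (cvM d L mv kk hL) x')| ≤ π * (d + 1) / (((L ^ kk : ℕ) : ℝ) * ((L ^ mv : ℕ) : ℝ)) :=
  abs_bcube_cover_fine_sub_le 2 hM hw k (x', 0)

/-- ★ `hfit₁` ON SITES: `|χ̃′_k(x′ + e′_μ) − χ̃_k(πx′ + e_μ)| ≤ 2π(d+1)∕(L^kk w)` (dag-n15-w4 `abs_bcube_cover_lift_shift_fine_sub_le` at `((x′,0), i)`, weakened by `2`).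
[cite: Balaban1985BackgroundPropagators, (3.62)–(3.65) pp.402–403 (shape), Thm 3.14 pp.426–427 (difference template)] -/
theorem abs_scBump'_scShift'_sub_le (k : Fin (d + 1) → ZMod (2 * L)) (μ : Fin (d + 1)) (p' : ScX' d L mv kk r hL × ι) :
    |((fun p' : ScX' d L mv kk r hL × ι => scBump' d L mv kk r hL k p'.1) ∘ (liftEquiv (scShift' d L mv kk r hL μ) ι)) p' -
        ((fun p : ScX d L mv kk hL × ι => scBump d L mv kk hL k p.1) ∘ (liftEquiv (scShift d L mv kk hL μ) ι)) (liftMap (kingPr L kk r (cvM d L mv kk hL)) ι p')| ≤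
      2 * (π * (d + 1) / (((L ^ kk : ℕ) : ℝ) * ((L ^ mv : ℕ) : ℝ))) := by
  have h := abs_bcube_cover_lift_shift_fine_sub_le 2 ι hM hw k μ ((p'.1, 0), p'.2)
  have h0 : 0 ≤ π * (d + 1) / (((L ^ kk : ℕ) : ℝ) * ((L ^ mv : ℕ) : ℝ)) := by positivity
  exact h.trans (by linarith)

/-- ★ `hfit₁b` ON SITES: `|χ̃′_k(x′ − e′_μ) − χ̃_k(πx′ − e_μ)| ≤ 2π(d+1)∕(L^kk w)` (dag-n15-w4 `abs_bcube_cover_lift_shift_symm_fine_sub_le` at `((x′,0), i)`; the inverse shifts agree with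
the bond ones by n15-c∕260∕260′ `scShift(′)_symm_apply`). [cite: Balaban1985BackgroundPropagators, (3.62)–(3.65) pp.402–403 (shape), Thm 3.14 pp.426–427 (difference template)] -/
theorem abs_scBump'_scShift'_symm_sub_le (k : Fin (d + 1) → ZMod (2 * L)) (μ : Fin (d + 1)) (p' : ScX' d L mv kk r hL × ι) :
    |((fun p' : ScX' d L mv kk r hL × ι => scBump' d L mv kk r hL k p'.1) ∘ (liftEquiv (scShift' d L mv kk r hL μ) ι).symm) p' -
        ((fun p : ScX d L mv kk hL × ι => scBump d L mv kk hL k p.1) ∘ (liftEquiv (scShift d L mv kk hL μ) ι).symm) (liftMap (kingPr L kk r (cvM d L mv kk hL)) ι p')| ≤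
      2 * (π * (d + 1) / (((L ^ kk : ℕ) : ℝ) * ((L ^ mv : ℕ) : ℝ))) := by
  have h := abs_bcube_cover_lift_shift_symm_fine_sub_le 2 ι hM hw k μ ((p'.1, 0), p'.2)
  simp only [Function.comp_apply, liftEquiv_symm_apply, kingPrV_eq] at h ⊢
  rw [scBump'_eq, scBump_eq, scShift'_symm_apply, scShift_symm_apply]
  exact h

/-- ★ `hfit₂` ON SITES: `|∇′_μχ̃′_k(x′) − ∇_μχ̃_k(πx′)| ≤ w⁻¹(L^kk w)⁻¹(32π⁴ + π²(d+1))` (dag-n15-w4 `abs_fgrad_bcube_cover_lift_two_grid_le` at `((x′,0), i)`; radius `2`, `4 ≤ L`).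
[cite: Balaban1985BackgroundPropagators, (3.62)–(3.65) pp.402–403 (shape), Thm 3.14 pp.426–427 (difference template)] -/
theorem abs_fgrad_scBump'_sub_le (hL4 : 4 ≤ L) (k : Fin (d + 1) → ZMod (2 * L)) (μ : Fin (d + 1)) (p' : ScX' d L mv kk r hL × ι) :
    |fgrad ((L ^ r * L ^ kk : ℕ) : ℝ) (liftEquiv (scShift' d L mv kk r hL μ) ι) (fun p' : ScX' d L mv kk r hL × ι => scBump' d L mv kk r hL k p'.1) p' -
        fgrad ((L ^ kk : ℕ) : ℝ) (liftEquiv (scShift d L mv kk hL μ) ι) (fun p : ScX d L mv kk hL × ι => scBump d L mv kk hL k p.1) (liftMap (kingPr L kk r (cvM d L mv kk hL)) ι p')| ≤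
      (((L ^ mv : ℕ) : ℝ))⁻¹ * (((L ^ kk : ℕ) : ℝ) * ((L ^ mv : ℕ) : ℝ))⁻¹ * (32 * π ^ 4 + π ^ 2 * (d + 1)) := by
  have h4 : (4 : ℝ) ≤ L := by exact_mod_cast hL4
  have hRq : 2 * (2 : ℝ) + 4 ≤ ((2 * L : ℕ) : ℝ) := by push_cast; linarith
  have h := abs_fgrad_bcube_cover_lift_two_grid_le 2 ι hM hw (by norm_num) hRq k μ ((p'.1, 0), p'.2)
  simp only [fgrad_apply, liftEquiv_apply, kingPrV_eq] at h ⊢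
  exact h

/-- ★ `hfit₂b` ON SITES: `|∇′*_μχ̃′_k(x′) − ∇*_μχ̃_k(πx′)| ≤ w⁻¹(L^kk w)⁻¹(32π⁴ + π²(d+1))` (dag-n15-w4 `abs_bgrad_bcube_cover_lift_two_grid_le` at `((x′,0), i)`; `4 ≤ L`).
[cite: Balaban1985BackgroundPropagators, (3.62)–(3.65) pp.402–403 (shape), Thm 3.14 pp.426–427 (difference template)] -/
theorem abs_bgrad_scBump'_sub_le (hL4 : 4 ≤ L) (k : Fin (d + 1) → ZMod (2 * L)) (μ : Fin (d + 1)) (p' : ScX' d L mv kk r hL × ι) :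
    |bgrad ((L ^ r * L ^ kk : ℕ) : ℝ) (liftEquiv (scShift' d L mv kk r hL μ) ι) (fun p' : ScX' d L mv kk r hL × ι => scBump' d L mv kk r hL k p'.1) p' -
        bgrad ((L ^ kk : ℕ) : ℝ) (liftEquiv (scShift d L mv kk hL μ) ι) (fun p : ScX d L mv kk hL × ι => scBump d L mv kk hL k p.1) (liftMap (kingPr L kk r (cvM d L mv kk hL)) ι p')| ≤
      (((L ^ mv : ℕ) : ℝ))⁻¹ * (((L ^ kk : ℕ) : ℝ) * ((L ^ mv : ℕ) : ℝ))⁻¹ * (32 * π ^ 4 + π ^ 2 * (d + 1)) := by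
  have h4 : (4 : ℝ) ≤ L := by exact_mod_cast hL4
  have hRq : 2 * (2 : ℝ) + 4 ≤ ((2 * L : ℕ) : ℝ) := by push_cast; linarith
  have h := abs_bgrad_bcube_cover_lift_two_grid_le 2 ι hM hw (by norm_num) hRq k μ ((p'.1, 0), p'.2)
  simp only [bgrad_apply, liftEquiv_symm_apply, kingPrV_eq] at h ⊢
  rw [scBump'_eq, scBump'_eq, scBump_eq, scBump_eq, scShift'_symm_apply, scShift_symm_apply]
  exact h

end Bump

/-! ## §2 The partition's two-grid fits on sites (`hf1`, `hf1b`, `hf2`, `hfh`, `hrh′`) -/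

section Partition

include hM hw

/-- ★ `hf1` ON SITES: `|∇′_μh′_k(x′) − ∇_μh_k(πx′)| ≤ |w⁻¹|(L^kk w)⁻¹(64π² + π²|Fin(d+1)|)` (n15-c FILE 122 `abs_fgrad_coverH_lift_two_grid_le` at `((x′,0), i)`; `3 ≤ L^kk w`).
[cite: Balaban1985BackgroundPropagators, Thm 3.14 pp.426–427 (difference template); Balaban1984PropagatorsII, (2.36) p.229 (shape)] -/
theorem abs_fgrad_scH'_sub_le (h3 : 3 ≤ L ^ kk * L ^ mv) (k : Fin (d + 1) → ZMod (2 * L)) (μ : Fin (d + 1)) (p' : ScX' d L mv kk r hL × ι) :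
    |fgrad ((L ^ r * L ^ kk : ℕ) : ℝ) (liftEquiv (scShift' d L mv kk r hL μ) ι) (fun p : ScX' d L mv kk r hL × ι => scH' d L mv kk r hL k p.1) p' -
        fgrad ((L ^ kk : ℕ) : ℝ) (liftEquiv (scShift d L mv kk hL μ) ι) (fun p : ScX d L mv kk hL × ι => scH d L mv kk hL k p.1) (liftMap (kingPr L kk r (cvM d L mv kk hL)) ι p')| ≤
      |(((L ^ mv : ℕ) : ℝ))⁻¹| * (((L ^ kk : ℕ) : ℝ) * ((L ^ mv : ℕ) : ℝ))⁻¹ * (64 * π ^ 2 + π ^ 2 * Fintype.card (Fin (d + 1))) := by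
  have h := abs_fgrad_coverH_lift_two_grid_le ι hM hw h3 k μ ((p'.1, 0), p'.2)
  simp only [fgrad_apply, liftEquiv_apply, kingPrV_eq] at h ⊢
  exact h

/-- ★ `hf1b` ON SITES: `|∇′*_μh′_k(x′) − ∇*_μh_k(πx′)| ≤ |w⁻¹|(L^kk w)⁻¹(64π² + π²|Fin(d+1)|)` (n15-c FILE 122 `abs_bgrad_coverH_lift_two_grid_le` at `((x′,0), i)`; `3 ≤ L^kk w`).
[cite: Balaban1985BackgroundPropagators, Thm 3.14 pp.426–427 (difference template); Balaban1984PropagatorsII, (2.36) p.229 (shape)] -/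
theorem abs_bgrad_scH'_sub_le (h3 : 3 ≤ L ^ kk * L ^ mv) (k : Fin (d + 1) → ZMod (2 * L)) (μ : Fin (d + 1)) (p' : ScX' d L mv kk r hL × ι) :
    |bgrad ((L ^ r * L ^ kk : ℕ) : ℝ) (liftEquiv (scShift' d L mv kk r hL μ) ι) (fun p : ScX' d L mv kk r hL × ι => scH' d L mv kk r hL k p.1) p' -
        bgrad ((L ^ kk : ℕ) : ℝ) (liftEquiv (scShift d L mv kk hL μ) ι) (fun p : ScX d L mv kk hL × ι => scH d L mv kk hL k p.1) (liftMap (kingPr L kk r (cvM d L mv kk hL)) ι p')| ≤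
      |(((L ^ mv : ℕ) : ℝ))⁻¹| * (((L ^ kk : ℕ) : ℝ) * ((L ^ mv : ℕ) : ℝ))⁻¹ * (64 * π ^ 2 + π ^ 2 * Fintype.card (Fin (d + 1))) := by
  have h := abs_bgrad_coverH_lift_two_grid_le ι hM hw h3 k μ ((p'.1, 0), p'.2)
  simp only [bgrad_apply, liftEquiv_symm_apply, kingPrV_eq] at h ⊢
  rw [← scShift'_symm_apply, ← scShift_symm_apply] at h
  exact h

/-- ★ `hf2` ON SITES: `|∇′ᵀ_μ∇′_μh′_k(x′) − ∇ᵀ_μ∇_μh_k(πx′)| ≤ (w⁻¹)²(L^kk w)⁻¹(144π³ + 32π³|Fin(d+1)|)` (n15-c FILE 122 `abs_fgradAdj_fgrad_coverH_lift_two_grid_le` at `((x′,0), i)`; `3 ≤ L^kk w`).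
[cite: Balaban1985BackgroundPropagators, Thm 3.14 pp.426–427 (difference template); Balaban1984PropagatorsII, (2.36) p.229 (shape)] -/
theorem abs_fgradAdj_fgrad_scH'_sub_le (h3 : 3 ≤ L ^ kk * L ^ mv) (k : Fin (d + 1) → ZMod (2 * L)) (μ : Fin (d + 1)) (p' : ScX' d L mv kk r hL × ι) :
    |fgradAdj ((L ^ r * L ^ kk : ℕ) : ℝ) (liftEquiv (scShift' d L mv kk r hL μ) ι) (fgrad ((L ^ r * L ^ kk : ℕ) : ℝ) (liftEquiv (scShift' d L mv kk r hL μ) ι)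
          (fun p : ScX' d L mv kk r hL × ι => scH' d L mv kk r hL k p.1)) p' -
        fgradAdj ((L ^ kk : ℕ) : ℝ) (liftEquiv (scShift d L mv kk hL μ) ι) (fgrad ((L ^ kk : ℕ) : ℝ) (liftEquiv (scShift d L mv kk hL μ) ι)
          (fun p : ScX d L mv kk hL × ι => scH d L mv kk hL k p.1)) (liftMap (kingPr L kk r (cvM d L mv kk hL)) ι p')| ≤
      (((L ^ mv : ℕ) : ℝ))⁻¹ ^ 2 * (((L ^ kk : ℕ) : ℝ) * ((L ^ mv : ℕ) : ℝ))⁻¹ * (144 * π ^ 3 + 32 * π ^ 3 * Fintype.card (Fin (d + 1))) := by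
  have h := abs_fgradAdj_fgrad_coverH_lift_two_grid_le ι hM hw h3 k μ ((p'.1, 0), p'.2)
  simp only [fgradAdj_apply, fgrad_apply, liftEquiv_apply, liftEquiv_symm_apply, Equiv.apply_symm_apply, kingPrV_eq] at h ⊢
  rw [← scShift'_symm_apply, ← scShift_symm_apply] at h
  exact h

/-- ★ `hfh` ON SITES: `|h′_k(x′) − h_k(πx′)| ≤ π(d+1)∕(L^kk w)` (FILE 67 `abs_coverH_fine_sub_le` at the bond `(x′, 0)`). [cite: Balaban1984PropagatorsII, (2.36) p.229 (shape)] -/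
theorem abs_scH'_sub_scH_kingPr_le (k : Fin (d + 1) → ZMod (2 * L)) (p' : ScX' d L mv kk r hL × ι) :
    |scH' d L mv kk r hL k p'.1 - scH d L mv kk hL k (kingPr L kk r (cvM d L mv kk hL) p'.1)| ≤ π * (d + 1) / (((L ^ kk : ℕ) : ℝ) * ((L ^ mv : ℕ) : ℝ)) :=
  abs_coverH_fine_sub_le kk r hM hw k (p'.1, 0)

/-- ★ `hrh′` ON SITES: `|h′_k(x′) − h^♭_k(B(πx′))| ≤ π(d+1)∕w` (n15-c FILE 122 `abs_coverH_sub_coverHb_kingPrV_le` at `((x′,0), i)`). [cite: Balaban1984PropagatorsII, (2.36) p.229 (shape)] -/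
theorem abs_scH'_sub_coverHb_kingPr_le (k : Fin (d + 1) → ZMod (2 * L)) (p' : ScX' d L mv kk r hL × ι) :
    |scH' d L mv kk r hL k p'.1 - coverHb (cvM d L mv kk hL) (L ^ kk) (L ^ mv) L k (liftBlk (scBlk d L mv kk hL ∘ kingPr L kk r (cvM d L mv kk hL)) ι p')| ≤ π * (d + 1) / ((L ^ mv : ℕ) : ℝ) :=
  abs_coverH_sub_coverHb_kingPrV_le ι hM hw k ((p'.1, 0), p'.2)

end Partition

/-! ## §3 The pairing's step and the supports on sites (`hstep′`, `hSχ`, `hSψ`, `hSχ′`, `hSψ′`) -/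

section Geometry

/-- ★ `hstep′` ON SITES: `dist(B(π(x′ + e′_μ)), B(πx′)) ≤ 1` (n15-c FILE 122 `dist_blockOf_kingPrV_step_le` at the bond `(x′, 0)`). [folklore] -/
theorem dist_scBlk_kingPr_scShift'_le (μ : Fin (d + 1)) (x' : ScX' d L mv kk r hL) :
    (unitTorusGeo L kk (cvM d L mv kk hL)).dist (scBlk d L mv kk hL (kingPr L kk r (cvM d L mv kk hL) (scShift' d L mv kk r hL μ x'))) (scBlk d L mv kk hL (kingPr L kk r (cvM d L mv kk hL) x')) ≤ 1 :=
  dist_blockOf_kingPrV_step_le (M := cvM d L mv kk hL) μ (x', 0)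

variable (hm₁ : 2 * L ^ mv ≤ coverMargin L mv) (hfitI : coverMargin L mv - 2 * L ^ mv + (6 * L ^ mv + 1) ≤ L * L ^ mv) (hS0 : L * L ^ mv ≤ 2 * L * L ^ mv)

include hM hm₁ hfitI hS0 in
/-- `hSχ` ON SITES: `χ_k(x) ≠ 0 ⟹ B(x) ∈ 𝔅_k` (the box lies in the cube; n15-c `blockOf_mem_cubeBlocks_of_inner_ne_zero` at `(x, 0)`, as in n15-c∕262). [cite: Balaban1985BackgroundPropagators, (3.62)–(3.65) pp.402–403 (shape)] -/
theorem scBlk_mem_cvSk_of_scChi_ne_zero {k : Fin (d + 1) → ZMod (2 * L)} {x : ScX d L mv kk hL} (hx : scChi d L mv kk hL k x ≠ 0) :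
    scBlk d L mv kk hL x ∈ cvSk d L mv kk hL k :=
  Finset.mem_coe.mpr (blockOf_mem_cubeBlocks_of_inner_ne_zero hM hm₁ hfitI hS0 hx)

/-- `hSψ` ON SITES: `ψ_k(x) ≠ 0 ⟹ B(x) ∈ 𝔅_k` (by definition of the plateau indicator). [folklore] -/
theorem scBlk_mem_cvSk_of_scPsi_ne_zero {k : Fin (d + 1) → ZMod (2 * L)} {x : ScX d L mv kk hL} (hx : scPsi d L mv kk hL k x ≠ 0) :
    scBlk d L mv kk hL x ∈ cvSk d L mv kk hL k :=
  Finset.mem_coe.mpr (by by_contra h; exact hx (chiCube_of_not_mem h))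

include hM hm₁ hfitI hS0 in
/-- ★ `hSχ′` ON SITES: `χ′_k(x′) ≠ 0 ⟹ B(πx′) ∈ 𝔅_k` (n15-c FILE 122 `blockOf_kingPrV_mem_cubeBlocks_of_inner_ne_zero` at `(x′, 0)`). [cite: Balaban1985BackgroundPropagators, (3.62)–(3.65) pp.402–403 (shape)] -/
theorem scBlk_kingPr_mem_cvSk_of_scChi'_ne_zero {k : Fin (d + 1) → ZMod (2 * L)} {x' : ScX' d L mv kk r hL} (hx : scChi' d L mv kk r hL k x' ≠ 0) :
    scBlk d L mv kk hL (kingPr L kk r (cvM d L mv kk hL) x') ∈ cvSk d L mv kk hL k :=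
  blockOf_kingPrV_mem_cubeBlocks_of_inner_ne_zero (x' := (x', 0)) hM hm₁ hfitI hS0 hx

/-- ★ `hSψ′` ON SITES: `ψ′_k(x′) ≠ 0 ⟹ B(πx′) ∈ 𝔅_k` (n15-c FILE 122 `blockOf_kingPrV_mem_cubeBlocks_of_chiCube_ne_zero` at `(x′, 0)`). [folklore] -/
theorem scBlk_kingPr_mem_cvSk_of_scPsi'_ne_zero {k : Fin (d + 1) → ZMod (2 * L)} {x' : ScX' d L mv kk r hL} (hx : scPsi' d L mv kk r hL k x' ≠ 0) :
    scBlk d L mv kk hL (kingPr L kk r (cvM d L mv kk hL) x') ∈ cvSk d L mv kk hL k :=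
  blockOf_kingPrV_mem_cubeBlocks_of_chiCube_ne_zero (x' := (x', 0)) hx

end Geometry

/-! ## §4 The two-grid tail defect VANISHES on sites (`hDT`) -/

section Tail

variable [Fintype ι] [DecidableEq ι]
include hw

/-- ★ `hDT` ON SITES: both tail operators `M_{h_k}∘N_L∘M_{1−χ̃_k}` are ZERO on the (PC) site carriers (n15-c∕261 `mulOp_scH_comp_scQQ_comp_one_sub_scBump`, 261′ likewise), so their two-grid
η-defect through any right factors is `0 ≤ 1_S(y)1_S(y′)·rF·e^{−ρ_T d}` for every `rF ≥ 0`, `ρ_T`, and all masses `a, a′`. [cite: Balaban1984PropagatorsII, (2.92)–(2.93) p.239 (the tail term: shape)] -/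
theorem hasMaj_idef_tail_scCube (a a' : ℝ) {rF : ℝ} (hrF : 0 ≤ rF) (ρT : ℝ) (k : Fin (d + 1) → ZMod (2 * L)) :
    HasMaj (ScNorm d L mv kk hL ι) (BlockNorm.ofBlocks (unitTorusGeo L kk (cvM d L mv kk hL)) (liftBlk (scBlk d L mv kk hL ∘ kingPr L kk r (cvM d L mv kk hL)) ι))
      (idef (pull (liftMap (kingPr L kk r (cvM d L mv kk hL)) ι)) (pull (liftMap (kingPr L kk r (cvM d L mv kk hL)) ι))
        ((-(mulOp (fun p : ScX' d L mv kk r hL × ι => scH' d L mv kk r hL k p.1) ∘ₗ scQQ' d L mv kk r hL a' ι ∘ₗ mulOp (1 - fun p : ScX' d L mv kk r hL × ι => scBump' d L mv kk r hL k p.1))) ∘ₗ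
          scCube' d L mv kk r hL a' ι k)
        ((-(mulOp (fun p : ScX d L mv kk hL × ι => scH d L mv kk hL k p.1) ∘ₗ scQQ d L mv kk hL a ι ∘ₗ mulOp (1 - fun p : ScX d L mv kk hL × ι => scBump d L mv kk hL k p.1))) ∘ₗ
          scCube d L mv kk hL a ι k))
      (fun y y' => ind (cvSk d L mv kk hL k) y * ind (cvSk d L mv kk hL k) y' * (rF * Real.exp (-(ρT * (unitTorusGeo L kk (cvM d L mv kk hL)).dist y y')))) := by
  rw [mulOp_scH_comp_scQQ_comp_one_sub_scBump ι hw a k, mulOp_scH'_comp_scQQ'_comp_one_sub_scBump' ι hw a' k]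
  simp only [neg_zero, LinearMap.zero_comp, idef_zero]
  exact (hasMaj_zero _ _).mono fun y y' => mul_nonneg (mul_nonneg (ind_nonneg _ _) (ind_nonneg _ _)) (mul_nonneg hrF (Real.exp_nonneg _))

end Tail

end Summit.QuantumFields.YangMills.BalabanUVNodes.N15.Gluing

end
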